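import Literature.IUT.HodgeTheaters.PiAvatarBinding
import Literature.IUT.HodgeTheaters.PiAvatarOrbitCategoryAut
import Literature.IUT.HodgeTheaters.PiAvatarFlStarCharacter
import HarnessLib

/-!
# The kit slot `toFlStar : Aut(𝒟^{⊚±}) → 𝔽_l^⋇` ([IUTchI] Def 6.1 (v)) AT THE GENUINE INITIAL Θ-DATA, assembled from
# abc-iut-w4-d065's `toFlStarOfNormalizer` and abc-iut-L5-t4's `OrbitCat.autEquiv` (KIT-INSTANCE-SPEC P5-binding /
# D13-P3-v; defs — post-freeze additive D13, not a cone member)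

S. Mochizuki, *Inter-universal Teichmüller theory I*, kurims manuscript (May 2020), Def 3.1 (c)(d) p. 62 (`K = F(E[l])`,
`X̲_K → X_K` "determined by the rank one quotient of `Δ_X^{ab} ⊗ 𝔽_l`"), Def 6.1 (v) p. 158 ("this rank one quotient
determines a natural surjective homomorphism `Aut(𝒟^{⊚±}) ↠ 𝔽_l^⋇` … whose kernel we denote by `Aut_±(𝒟^{⊚±})`")
([IUTchI] Def 6.1 (v) p.158) [claim: Mochizuki2012, status: disputed] (D-0012 claim key, series status DISPUTED —
definitions over abc-iut-L5-t2's REAL `InitialThetaData` in the Π-avatar (design D1 EMBEDDED); nothing of the series is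
asserted, no side is taken on [IUTchIII] Cor. 3.12).

WHAT IS BUILT.  With `Y := Π_{X̲_K} = D.PiXund`, `X := Π_{X_K} = D.PiXK` (so `X/Y = Gal(X̲_K/X_K)`, the rank-one quotient, of
order `l` — `PiXund_relIndex_PiXK` from abc-iut-L5-t2's `ThetaGeometry.PiXbar_relIndex`) and `A := Π_{C_F} = D.PiC`:
* `InitialThetaData.PiCK_eq_comap_augGF` (`Π_{C_K} = augGF⁻¹(G_K)`), `map_augGF_PiXund` (`augGF(Π_{X̲_K}) = G_K`),
  `PiXK_eq_map` (`Π_{X_K}` = the image of t1's `Π_X` along `embK`), `PiXund_relIndex_PiXK : [Π_{X_K} : Π_{X̲_K}] = l`;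
* **`normalizer_PiXund_le_normalizer_PiXK`** — `N_A(Π_{X̲_K}) ≤ N_A(Π_{X_K})` (an element normalising `Π_{X̲_K}` normalises
  its `augGF`-image `G_K`, hence `augGF⁻¹(G_K) = Π_{C_K}`, and the NORMAL subgroup `Π_{X_F}`; so every automorphism of
  `𝒟^{⊚±} = ℬ(Π_{X̲_K})⁰` acts on the rank-one quotient — the reason print's homomorphism is defined on ALL of `Aut(𝒟^{⊚±})`);
* **`InitialThetaData.toFlStarGlobal : Aut (D.gModelObj) →* FlStar l`** — the kit slot `toFlStar gModel`: abc-iut-L5-t4's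
  `OrbitCat.autEquiv Π_{X̲_K} : N_A(Π_{X̲_K})/Π_{X̲_K} ≃* Aut(𝒟^{⊚±})` (p424570) followed by abc-iut-w4-d065's
  `toFlStarOfNormalizer Π_{X̲_K} Π_{X_K}` (p4225xx `PiAvatarFlStarCharacter`: the exponent of the conjugation action on
  `X/Y ≅ ℤ/l`, read in `𝔽_l^⋇ = 𝔽_l^×/{±1}`), descended modulo `Π_{X̲_K}` (`toFlStarOfNormalizer_eq_one_of_mem`) and
  (`toFlStarGlobal_autOfNormalizer`: on `xΠ ↦ xmΠ` it is the INVERSE of d065's character of `m`, because `autEquiv`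
  sends the class of `n` to `xΠ ↦ xn⁻¹Π` — immaterial for kernel and surjectivity); `toFlStarGlobal_eq_one_of_mem_PiXK` (automorphisms induced by `Π_{X_K}` — e.g.
  `Gal(X̲_K/X_K)` — lie in the kernel `Aut_±`).
HYPOTHESIS (instance argument, to be supplied from abc-iut-L5-t1's IR-A companion `CuspGalois.normal_PiXbar` once its
proofs file lands): `[(D.PiXund.subgroupOf D.PiXK).Normal]` — `X̲_K → X_K` is Galois (print: cyclic of order `l`).
The SURJECTIVITY clause of Def 6.1 (v) (`toFlStar_surjective` of the kit) is NOT proved here: it is the arithmetic input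
Def 3.1 (c) (`Gal(K/F) ⊇ SL₂(𝔽_l)`), reduced by d065's `toFlStarOfNormalizer_surjective_iff` to a split-torus sentence.
No instance/notation declared (the `Normal` hypothesis is a binder); typed ≠ proved elsewhere.
-/

noncomputable section

namespace Literature.IUT.HodgeTheaters

open CategoryTheory

universe u v w

section ToFlStar

variable {F : Type u} {K : Type v} {Fbar : Type w} [Field F] [NumberField F] [Field K] [NumberField K]
  [Algebra F K] [Field Fbar] [Algebra F Fbar] [Algebra K Fbar]
  {E : WeierstrassCurve F} [E.IsElliptic] {l : ℕ} {Pb : BadPlacePredicates K}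
  (D : InitialThetaData F K Fbar E l Pb)

namespace InitialThetaData

/-! ### `Π_{C_K} = augGF⁻¹(G_K)`, `augGF(Π_{X̲_K}) = G_K`, `[Π_{X_K} : Π_{X̲_K}] = l` -/

/-- `Π_{C_K} = augGF⁻¹(G_K)` inside `Π_{C_F}` (Def 3.1 (d): `Π_{C_K} := Π_{C_F} ×_{G_F} G_K`; t2's `ThetaGeometry.embK_range`).
([IUTchI] Def 3.1 (d) p.62) [claim: Mochizuki2012, status: disputed] -/
theorem PiCK_eq_comap_augGF : D.PiCK = (galoisSubgroupOf F K Fbar).comap D.augGF := by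
  rw [InitialThetaData.PiCK, D.geom.embK_range]
  rfl

/-- `augGF(Π_{X̲_K}) = G_K` (Def 3.1 (d): `Π_{X̲_K} ↠ G_K`, t2's `galoisSubgroupOf_le_map_PiXund`; and `Π_{X̲_K} ≤ Π_{C_K}`).
([IUTchI] Def 3.1 (d) p.62) [claim: Mochizuki2012, status: disputed] -/
theorem map_augGF_PiXund : D.PiXund.map D.augGF = galoisSubgroupOf F K Fbar := by
  refine le_antisymm ?_ D.galoisSubgroupOf_le_map_PiXund
  rw [Subgroup.map_le_iff_le_comap, ← PiCK_eq_comap_augGF]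
  exact D.PiXund_le_PiCK

/-- `Π_{X_K} = Π_{X_F} ∩ Π_{C_K}` is the image of t1's `Π_X` along `embK` (t2's `ThetaGeometry.embK_PiX`).
([IUTchI] Def 3.1 (d) p.62) [claim: Mochizuki2012, status: disputed] -/
theorem PiXK_eq_map : D.PiXK = D.geom.pe.PiX.map D.geom.embK := by
  rw [InitialThetaData.PiXK, InitialThetaData.PiCK, D.geom.embK_PiX]

/-- **`[Π_{X_K} : Π_{X̲_K}] = l`** — the rank-one quotient `Gal(X̲_K/X_K)` has order `l` (Def 3.1 (d) "`X̲_K` of type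
`(1,l-tors)`"; t2's `ThetaGeometry.PiXbar_relIndex` along the injective `embK`). ([IUTchI] Def 3.1 (d) p.62) [claim: Mochizuki2012, status: disputed] -/
theorem PiXund_relIndex_PiXK : D.PiXund.relIndex D.PiXK = l := by
  rw [PiXK_eq_map, InitialThetaData.PiXund, Subgroup.relIndex_map_map_of_injective _ _ D.geom.embK_injective]
  exact D.geom.PiXbar_relIndex

/-! ### Every automorphism of `𝒟^{⊚±}` normalises `Π_{X_K}` -/

/-- If `φ(n)` normalises `S ≤ G` then `n` normalises `φ⁻¹(S)` (plumbing). [folklore] -/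
private theorem mem_normalizer_comap_of_map {A' G' : Type*} [Group A'] [Group G'] (φ : A' →* G') (S : Subgroup G')
    {n : A'} (hn : φ n ∈ Subgroup.normalizer (S : Set G')) :
    n ∈ Subgroup.normalizer ((S.comap φ : Subgroup A') : Set A') := by
  rw [Subgroup.mem_normalizer_iff] at hn ⊢
  intro x
  rw [Subgroup.mem_comap, Subgroup.mem_comap, map_mul, map_mul, map_inv]
  exact hn (φ x)

/-- An element normalising `H` normalises its image `φ(H)` (plumbing). [folklore] -/
private theorem map_mem_normalizer_map {A' G' : Type*} [Group A'] [Group G'] (φ : A' →* G') (H : Subgroup A')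
    {n : A'} (hn : n ∈ Subgroup.normalizer (H : Set A')) :
    φ n ∈ Subgroup.normalizer ((H.map φ : Subgroup G') : Set G') := by
  rw [Subgroup.mem_normalizer_iff] at hn ⊢
  intro y
  constructor
  · rintro ⟨x, hx, rfl⟩
    refine ⟨n * x * n⁻¹, (hn x).mp hx, by rw [map_mul, map_mul, map_inv]⟩
  · rintro ⟨x, hx, hxy⟩
    refine ⟨n⁻¹ * x * n, ?_, ?_⟩
    · have h := (hn (n⁻¹ * x * n)).mpr
      apply h
      simpa [mul_assoc] using hx
    · rw [map_mul, map_mul, map_inv, hxy]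
      simp [mul_assoc]

/-- **`N_{Π_{C_F}}(Π_{X̲_K}) ≤ N_{Π_{C_F}}(Π_{X_K})`**: an element normalising `Π_{X̲_K}` normalises `augGF(Π_{X̲_K}) = G_K`, hence
`Π_{C_K} = augGF⁻¹(G_K)`, and `Π_{X_F} ⊴ Π_{C_F}`; so it normalises `Π_{X_K} = Π_{X_F} ∩ Π_{C_K}` — every automorphism of
`𝒟^{⊚±} = ℬ(Π_{X̲_K})⁰` acts on the rank-one quotient `Π_{X_K}/Π_{X̲_K}` ([IUTchI] Def 6.1 (v): the homomorphism
`Aut(𝒟^{⊚±}) → 𝔽_l^⋇` is defined on all of `Aut`). ([IUTchI] Def 6.1 (v) p.158) [claim: Mochizuki2012, status: disputed] -/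
theorem normalizer_PiXund_le_normalizer_PiXK :
    Subgroup.normalizer ((D.PiXund : Subgroup D.PiC) : Set D.PiC) ≤
      Subgroup.normalizer ((D.PiXK : Subgroup D.PiC) : Set D.PiC) := by
  intro n hn
  -- `n` normalises `Π_{C_K} = augGF⁻¹(G_K)` since `augGF n` normalises `G_K = augGF(Π_{X̲_K})`
  have hCK : n ∈ Subgroup.normalizer ((D.PiCK : Subgroup D.PiC) : Set D.PiC) := by
    rw [PiCK_eq_comap_augGF]
    apply mem_normalizer_comap_of_map
    have h := map_mem_normalizer_map D.augGF D.PiXund hn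
    rw [map_augGF_PiXund] at h
    exact h
  -- `n` normalises the normal subgroup `Π_{X_F}`
  have hXF : n ∈ Subgroup.normalizer ((D.geom.PiX : Subgroup D.PiC) : Set D.PiC) := by
    haveI := D.geom.PiX_normal
    rw [Subgroup.normalizer_eq_top]
    exact Subgroup.mem_top n
  rw [Subgroup.mem_normalizer_iff] at hCK hXF ⊢
  intro x
  change x ∈ D.geom.PiX ⊓ D.PiCK ↔ n * x * n⁻¹ ∈ D.geom.PiX ⊓ D.PiCK
  rw [Subgroup.mem_inf, Subgroup.mem_inf, hXF x, hCK x]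

/-- The inclusion `N(Π_{X̲_K}) ↪ N(Π_{X_K}) ∩ N(Π_{X̲_K})` (domain of abc-iut-w4-d065's `toFlStarOfNormalizer`).
([IUTchI] Def 6.1 (v) p.158) [claim: Mochizuki2012, status: disputed] -/
def normalizerIncl :
    ↥(Subgroup.normalizer ((D.PiXund : Subgroup D.PiC) : Set D.PiC)) →*
      ↥(Subgroup.normalizer ((D.PiXK : Subgroup D.PiC) : Set D.PiC) ⊓
        Subgroup.normalizer ((D.PiXund : Subgroup D.PiC) : Set D.PiC)) :=
  Subgroup.inclusion (le_inf D.normalizer_PiXund_le_normalizer_PiXK le_rfl)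

/-- The inclusion is the identity on underlying elements. ([IUTchI] Def 6.1 (v) p.158) [claim: Mochizuki2012, status: disputed] -/
@[simp] theorem coe_normalizerIncl (n : ↥(Subgroup.normalizer ((D.PiXund : Subgroup D.PiC) : Set D.PiC))) :
    ((D.normalizerIncl n : ↥(Subgroup.normalizer ((D.PiXK : Subgroup D.PiC) : Set D.PiC) ⊓
        Subgroup.normalizer ((D.PiXund : Subgroup D.PiC) : Set D.PiC))) : D.PiC) = (n : D.PiC) := rfl

/-! ### The kit slot `toFlStar` at `𝒟^{⊚±}` -/

variable [Fact l.Prime] [hN : (D.PiXund.subgroupOf D.PiXK).Normal]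

/-- d065's character on `N(Π_{X̲_K})` (through the inclusion): `n ↦` the class in `𝔽_l^⋇` of the exponent by which
conjugation by `n` acts on `Π_{X_K}/Π_{X̲_K} ≅ ℤ/l`. ([IUTchI] Def 6.1 (v) p.158) [claim: Mochizuki2012, status: disputed] -/
def toFlStarOnNormalizer :
    ↥(Subgroup.normalizer ((D.PiXund : Subgroup D.PiC) : Set D.PiC)) →* FlStar l :=
  (toFlStarOfNormalizer D.PiXund D.PiXK D.PiXund_le_PiXK D.PiXund_relIndex_PiXK).comp D.normalizerIncl

/-- Elements of `Π_{X_K}` (in particular of `Π_{X̲_K}`) have trivial character (d065 `toFlStarOfNormalizer_eq_one_of_mem`).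
([IUTchI] Def 6.1 (v) p.158) [claim: Mochizuki2012, status: disputed] -/
theorem toFlStarOnNormalizer_eq_one_of_mem
    (n : ↥(Subgroup.normalizer ((D.PiXund : Subgroup D.PiC) : Set D.PiC))) (hn : (n : D.PiC) ∈ D.PiXK) :
    D.toFlStarOnNormalizer n = 1 :=
  toFlStarOfNormalizer_eq_one_of_mem D.PiXund_le_PiXK D.PiXund_relIndex_PiXK (D.normalizerIncl n) hn

/-- `Π_{X̲_K} ∩ N(Π_{X̲_K})` lies in the kernel of the character (so it descends to `N/Π_{X̲_K} = Aut(𝒟^{⊚±})`).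
([IUTchI] Def 6.1 (v) p.158) [claim: Mochizuki2012, status: disputed] -/
theorem subgroupOf_le_ker_toFlStarOnNormalizer :
    D.PiXund.subgroupOf (Subgroup.normalizer ((D.PiXund : Subgroup D.PiC) : Set D.PiC)) ≤
      (D.toFlStarOnNormalizer).ker := by
  intro n hn
  rw [MonoidHom.mem_ker]
  exact D.toFlStarOnNormalizer_eq_one_of_mem n (D.PiXund_le_PiXK (Subgroup.mem_subgroupOf.mp hn))

/-- **The kit slot `toFlStar` at the genuine `𝒟^{⊚±}`** ([IUTchI] Def 6.1 (v) p.158: "`Aut(𝒟^{⊚±}) ↠ 𝔽_l^⋇` … determined by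
the rank one quotient"): `Aut(ℬ(Π_{X̲_K})⁰) ≅ N(Π_{X̲_K})/Π_{X̲_K}` (t4 `OrbitCat.autEquiv`) followed by d065's character,
descended modulo `Π_{X̲_K}`; since `autEquiv` sends the class of `n` to `xΠ ↦ xn⁻¹Π`, the value on `xΠ ↦ xmΠ` is the
INVERSE of the character of `m` (`toFlStarGlobal_autOfNormalizer`) — immaterial for the kernel `Aut_±` and for
surjectivity (inversion is a bijection of `𝔽_l^⋇`).
([IUTchI] Def 6.1 (v) p.158) [claim: Mochizuki2012, status: disputed] -/
def toFlStarGlobal : Aut (D.gModelObj) →* FlStar l :=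
  (QuotientGroup.lift _ (D.toFlStarOnNormalizer) D.subgroupOf_le_ker_toFlStarOnNormalizer).comp
    (OrbitCat.autEquiv D.PiXund).symm.toMonoidHom

/-- **`toFlStarGlobal` on the automorphism `xΠ_{X̲_K} ↦ xmΠ_{X̲_K}` is the inverse of d065's character of `m`.**
([IUTchI] Def 6.1 (v) p.158) [claim: Mochizuki2012, status: disputed] -/
theorem toFlStarGlobal_autOfNormalizer (m : D.PiC)
    (hm : m ∈ Subgroup.normalizer ((D.PiXund : Subgroup D.PiC) : Set D.PiC)) :
    D.toFlStarGlobal (OrbitCat.autOfNormalizer m hm) = (D.toFlStarOnNormalizer ⟨m, hm⟩)⁻¹ := by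
  have h1 : (OrbitCat.autOfNormalizer m hm : Aut (D.gModelObj)) =
      OrbitCat.autEquiv D.PiXund (QuotientGroup.mk ⟨m⁻¹, Subgroup.inv_mem _ hm⟩) := by
    rw [OrbitCat.autEquiv_mk, OrbitCat.autOfNormalizerHom_apply, OrbitCat.autOfNormalizer_eq_iff]
    simp
  have h2 : (OrbitCat.autEquiv D.PiXund).symm (OrbitCat.autOfNormalizer m hm) =
      QuotientGroup.mk ⟨m⁻¹, Subgroup.inv_mem _ hm⟩ := by
    rw [h1, MulEquiv.symm_apply_apply]
  have h3 : (⟨m⁻¹, Subgroup.inv_mem _ hm⟩ :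
      ↥(Subgroup.normalizer ((D.PiXund : Subgroup D.PiC) : Set D.PiC))) = ⟨m, hm⟩⁻¹ := rfl
  change QuotientGroup.lift _ (D.toFlStarOnNormalizer) D.subgroupOf_le_ker_toFlStarOnNormalizer
      ((OrbitCat.autEquiv D.PiXund).symm (OrbitCat.autOfNormalizer m hm)) = _
  rw [h2, QuotientGroup.lift_mk, h3, map_inv]

/-- Automorphisms of `𝒟^{⊚±}` induced by elements of `Π_{X_K}` normalising `Π_{X̲_K}` — e.g. the deck transformations
`Gal(X̲_K/X_K)` — have trivial `toFlStar` (they lie in `Aut_±`). ([IUTchI] Def 6.1 (v) p.158) [claim: Mochizuki2012, status: disputed] -/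
theorem toFlStarGlobal_eq_one_of_mem_PiXK (m : D.PiC)
    (hm : m ∈ Subgroup.normalizer ((D.PiXund : Subgroup D.PiC) : Set D.PiC)) (hmX : m ∈ D.PiXK) :
    D.toFlStarGlobal (OrbitCat.autOfNormalizer m hm) = 1 := by
  rw [toFlStarGlobal_autOfNormalizer, D.toFlStarOnNormalizer_eq_one_of_mem ⟨m, hm⟩ hmX, inv_one]

end InitialThetaData

end ToFlStar

end Literature.IUT.HodgeTheaters
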